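import Summits.QuantumFields.QCD.Theses.HeatSlicedQuarks

/-!
# Stub `stub_gramRepresentation` of line `Sketch`
(crux `Summit.QuantumFields.QCD.Theses.HeatSlicedQuarks.InterleavedHeatSliceFlow`, item stmt-QuantumFields-8891,
reshape r7, sliced Gram bound)

**Gram representation of the heat-slice covariance** (generic linear algebra).  For a complex square matrix `A`
over a finite index type put `H = Aᴴ A` and `K_t = e^{-tH}`.  For all real `s, a, b` and entries `ξ, η`,

  `∫_a^b (K_t Aᴴ)(ξ,η) dt = Σ_ζ K_s(ξ,ζ) · ∫_a^b (K_{t-s} Aᴴ)(ζ,η) dt`,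

i.e. the covariance entry is the `ℓ²` pairing of row `ξ` of `K_s` with column `η` of `∫_a^b K_{t-s} Aᴴ dt`.

Proof.  The scalar multiples `-s • H` and `-(t-s) • H` commute, so the semigroup law
`K_t = K_s K_{t-s}` is `Matrix.exp_add_of_commute`; then `(K_s (K_{t-s} Aᴴ))(ξ,η) = Σ_ζ K_s(ξ,ζ) (K_{t-s} Aᴴ)(ζ,η)`
(`Matrix.mul_apply`), and the (oriented) interval integral commutes with the finite sum
(`intervalIntegral.integral_finsetSum`) and with constant left factors (`intervalIntegral.integral_const_mul`).
Interval integrability of each summand follows from continuity of `t ↦ K_{t-s} Aᴴ`, obtained from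
`NormedSpace.exp_continuous` in the `L^∞` operator normed algebra structure `Matrix.Norms.Operator` (the
exponential and the topology do not depend on the chosen norm).  No hypotheses on `s, a, b`; Mathlib only.
-/

noncomputable section

namespace Summit.QuantumFields.QCD.Cruxes.InterleavedHeatSliceFlow.Sketch

open MeasureTheory intervalIntegral
open scoped Matrix

/-- Semigroup law for the heat kernel of a complex square matrix `H` with the time split at `s`:
`e^{-tH} = e^{-sH} e^{-(t-s)H}` for all real `s, t` (the two exponents are scalar multiples of `H`, hence
commute, and `Matrix.exp_add_of_commute` applies). -/
private theorem gramRepresentation_semigroup {ι : Type*} [Fintype ι] [DecidableEq ι]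
    (H : Matrix ι ι ℂ) (s t : ℝ) :
    NormedSpace.exp (-(t : ℂ) • H) =
      NormedSpace.exp (-(s : ℂ) • H) * NormedSpace.exp (-((t - s : ℝ) : ℂ) • H) := by
  have hsum : -(t : ℂ) • H = -(s : ℂ) • H + -((t - s : ℝ) : ℂ) • H := by
    rw [← add_smul]
    congr 1
    push_cast
    ring
  rw [hsum, Matrix.exp_add_of_commute _ _
    (((Commute.refl H).smul_left (-(s : ℂ))).smul_right (-((t - s : ℝ) : ℂ)))]

/-- Continuity of an entry of the shifted smoothed adjoint `t ↦ (e^{-(t-s)AᴴA} Aᴴ)(ζ,η)` (the matrix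
exponential is continuous for the `L^∞` operator normed algebra structure, whose topology is the product
one). -/
private theorem gramRepresentation_continuous {ι : Type*} [Fintype ι] [DecidableEq ι]
    (A : Matrix ι ι ℂ) (s : ℝ) (ζ η : ι) :
    Continuous fun t : ℝ => (NormedSpace.exp (-((t - s : ℝ) : ℂ) • (Aᴴ * A)) * Aᴴ) ζ η := by
  open scoped Matrix.Norms.Operator in
  exact ((NormedSpace.exp_continuous.comp
    ((Complex.continuous_ofReal.comp (continuous_sub_right s)).neg.smul continuous_const)).mul
      continuous_const).matrix_elem ζ η

/-- **Gram representation of the heat-slice covariance** (registered stub `stub_gramRepresentation` of line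
`Sketch`, reshape r7; generic linear algebra): for every complex square matrix `A` over a finite index type,
all real `s, a, b` and entries `ξ, η`,

  `∫_a^b (e^{-tAᴴA} Aᴴ)(ξ,η) dt = Σ_ζ e^{-sAᴴA}(ξ,ζ) · ∫_a^b (e^{-(t-s)AᴴA} Aᴴ)(ζ,η) dt`.

Semigroup law `e^{-tAᴴA} = e^{-sAᴴA} e^{-(t-s)AᴴA}` (`Matrix.exp_add_of_commute`) under the integral,
`Matrix.mul_apply`, and interchange of the interval integral with the finite sum and the constant left factors
(integrability by continuity). -/
theorem stub_gramRepresentation :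
    ∀ (ι : Type) [Fintype ι] [DecidableEq ι] (A : Matrix ι ι ℂ) (s a b : ℝ) (ξ η : ι),
      (∫ t in a..b, (NormedSpace.exp (-(t : ℂ) • (Aᴴ * A)) * Aᴴ) ξ η) =
        ∑ ζ, (NormedSpace.exp (-(s : ℂ) • (Aᴴ * A))) ξ ζ *
          ∫ t in a..b, (NormedSpace.exp (-((t - s : ℝ) : ℂ) • (Aᴴ * A)) * Aᴴ) ζ η := by
  intro ι _ _ A s a b ξ η
  -- pointwise in `t`: semigroup law and the entry of a matrix product
  have hpt : ∀ t : ℝ, (NormedSpace.exp (-(t : ℂ) • (Aᴴ * A)) * Aᴴ) ξ η =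
      ∑ ζ, (NormedSpace.exp (-(s : ℂ) • (Aᴴ * A))) ξ ζ *
        (NormedSpace.exp (-((t - s : ℝ) : ℂ) • (Aᴴ * A)) * Aᴴ) ζ η := fun t => by
    rw [gramRepresentation_semigroup (Aᴴ * A) s t, Matrix.mul_assoc, Matrix.mul_apply]
  -- integrability of each summand (continuity), then swap `∫` with `Σ` and the constant factors
  have hint : ∀ ζ : ι, IntervalIntegrable (fun t : ℝ => (NormedSpace.exp (-(s : ℂ) • (Aᴴ * A))) ξ ζ *
      (NormedSpace.exp (-((t - s : ℝ) : ℂ) • (Aᴴ * A)) * Aᴴ) ζ η) volume a b := fun ζ =>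
    (continuous_const.mul (gramRepresentation_continuous A s ζ η)).intervalIntegrable a b
  rw [intervalIntegral.integral_congr fun t _ => hpt t,
    intervalIntegral.integral_finsetSum fun ζ _ => hint ζ]
  exact Finset.sum_congr rfl fun ζ _ => intervalIntegral.integral_const_mul _ _

end Summit.QuantumFields.QCD.Cruxes.InterleavedHeatSliceFlow.Sketch

end
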